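import Summits.Parity.GeneralizedHardyLittlewood.Theses.MaynardProductExact
import Literature.NumberTheory.Sieve.MaynardProductKernelCert3750Lit
import Literature.NumberTheory.Sieve.MaynardProductKernelCert3750Table

/-! # Route `MaynardProductExact` — crux `NumLB3749` (stmt-Parity-19245): kernel slice facts 0–3 (literal log table)

Helper for `Theorems/MaynardProductExactNumLB3749.lean`: literal lower bounds `L_s ≤ NUMSUMSL TLIT s` for the slices
`s ∈ {0, 1, 2, 3}` of the `k = 3750` numerator kernel certificate (`…ProductKernelCert3750.FactSlL`), each by `decide +kernel` in its own
declaration (packed initial vector + 15 convolution products + one 2^16-slot slice read with the certified literal weight table `TLIT`; literals = exact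
slice sums of the prover's GMP mirror minus `2^150`).  No summit is proved by this file. -/

open Literature.NumberTheory.Sieve.MaynardTao.ProductKernelCert3750

namespace Summit.Parity.GeneralizedHardyLittlewood.MaynardProductExactNumLB3749

set_option maxHeartbeats 0 in
/-- kernel slice fact 0: `L_0 ≤ NUMSUMSL TLIT 0`. -/
theorem okSl0 : FactSlL TLIT 0 888425779255341279287309424489850393100641466283923382403799 = true := by decide +kernel
set_option maxHeartbeats 0 in
/-- kernel slice fact 1: `L_1 ≤ NUMSUMSL TLIT 1`. -/
theorem okSl1 : FactSlL TLIT 1 36812006923911455380084517001838234665501915186434976839700010 = true := by decide +kernel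
set_option maxHeartbeats 0 in
/-- kernel slice fact 2: `L_2 ≤ NUMSUMSL TLIT 2`. -/
theorem okSl2 : FactSlL TLIT 2 331089555579136358545337082849582879087569268619751909361341644 = true := by decide +kernel
set_option maxHeartbeats 0 in
/-- kernel slice fact 3: `L_3 ≤ NUMSUMSL TLIT 3`. -/
theorem okSl3 : FactSlL TLIT 3 1146072400280261097053938402104368879496748407143254210097024738 = true := by decide +kernel

end Summit.Parity.GeneralizedHardyLittlewood.MaynardProductExactNumLB3749
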